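import Mathlib
import HarnessLib
import Literature.MathematicalPhysics.QuantumLattice.WilsonPropagatorHeavyMass
import Literature.MathematicalPhysics.QuantumLattice.WilsonQuarkMatrixPositivity
import Literature.MathematicalPhysics.QuantumLattice.WilsonDiracRangeOne
import Summits.Ventures.LatticeQCDFlow.Scaling.LocalDeterminantDecoupling

/-!
# LatticeQCDFlow / Scaling — HEAVY-QUARK LOCALITY OF THE FERMION DETERMINANT: volume-uniform
# single-link Lipschitz bound and exponential two-link decoupling of `-log det D_W` for `κ < 1/8`

HONEST FRAMING: exact (Metropolis-corrected) sampling algorithms for lattice gauge theory;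
figures of merit are autocorrelation/cost numbers at stated couplings and volumes; no
continuum-physics claim.

THEORY-2.md §3.4 / §4 C5 / §5.4 `FermionDeterminantCost` (v4.4, theory seat GEN-25).  Conjecture C5
of the cell ("the fermionic effective action `-log det D(U)` has connected link–link couplings
decaying like the pion correlator") is what decides how the volume laws of an exact sampler
compose with the fermion determinant: the barrier text records "the logarithm of the fermion
determinant in the effective boson action is non-local" [cite: MontvayMunster1994, §7.4 (7.139)–(7.141)]
and prices an exact correction step at ONE GLOBAL determinant ratio.  This file proves C5 in the
HEAVY-QUARK REGIME — bare mass `m > 0`, i.e. hopping parameter `κ = 1/(2m + 8) < 1/8`, Wilson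
parameter `r = 1`, ANY unitary colour representation `ρ : G → U(N)`, EVERY periodic four-torus
`(ℤ/L)⁴` and EVERY gauge field — with constants depending on `N` and `m` ONLY:

* `abs_quarkEffAction_update_sub_le` — **single-link Lipschitz law**: for `U' = U` off one link,
  `|S_q(U') - S_q(U)| ≤ log ((8N)! · (1 + 128 N / m)^{8N})`, `S_q = -log det D_W(·, m)`
  (`quarkEffAction`; `det D_W > 0` for `m > 0` is the tree's `fermionDet_wilsonDirac_eq_ofReal_pos`).
  The change of the quark effective action under ANY single-link update is bounded uniformly in the
  volume: Montvay–Münster's `ΔS_eff = -log det (1 - K D[U,U'])` (7.139) is an `8N × 8N` determinant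
  (`LocalDet.det_one_add_eq_of_col_support`) of entries `≤ 1 + 8N·16/m`.
* `norm_fermionDet_crossRatio_sub_one_le` / `abs_exp_neg_secondDiff_quarkEffAction_sub_one_le` —
  **two-link decoupling law**: for two distinct links `ℓ₁, ℓ₂` whose endpoint sets are at cyclic
  distance `≥ R` in some coordinate direction `i`, the cross-ratio of determinants
  `det D(U₁₂)·det D(U) / (det D(U₁)·det D(U₂)) = exp (-Δ_{ℓ₁}Δ_{ℓ₂} S_q)` is within
  `((8N)! + 8N)·δ·(1 + δ)^{8N-1}` of `1` for every `δ ≥ 2¹⁷ N³ m⁻² (4/(m+4))^R` — the connected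
  two-link coupling of the quark effective action decays like `(4/(m+4))^R = (8κ)^R`, i.e. with
  localisation length `ξ(κ) = 1/log (1/(8κ))` lattice units, uniformly in `L` and in the field.

Inputs (all PROVED in the tree): the hopping-expansion decay of the heavy propagator
`‖D_W⁻¹(p,q)‖ ≤ m⁻¹ (4/(m+4))^{d_i(p,q)}` (`norm_inv_wilsonDirac_apply_le`,
[cite: MontvayMunster1994, §5.1.3]), positivity of `det D_W` for `m > 0`
(`isUnit_det_wilsonDirac`), and the abstract engine `Scaling/LocalDeterminant.lean`.  What is NOT
claimed: anything at `κ ≥ 1/8` (light quarks, where `ξ = 1/(a M_π)` is the conjecture C5 proper),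
optimal constants (the true rate is `arcosh`-type and the `(8N)!` is a Leibniz-expansion artefact),
`r ≠ 1`, improved or staggered actions.  NEW WORK of the cell over tree vocabulary
(`wilsonDirac`, `fermionDet`); the printed counterpart is the convergent hopping-parameter / loop
expansion of `Tr log Q` [cite: MontvayMunster1994, §5.1.3 (5.27)–(5.31)], which has no printed
volume-uniform Lipschitz / decoupling constants.
LANDING NOTE (lean-1 GEN-7 custody, LEAD LINE 168): imports `Scaling/LocalDeterminantDecoupling` (the second half of theory2's `LocalDeterminant.lean`, split at landing for the 400-line limit); five blank lines trimmed; no statement changed.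
-/

noncomputable section

namespace Summit.Ventures.LatticeQCDFlow.Scaling.HeavyQuark

open Matrix Finset Function
open Literature.Probability.LatticeModels (TorusSite)
open Literature.MathematicalPhysics.QuantumFieldTheory
open Literature.MathematicalPhysics.QuantumLattice
open Summit.Ventures.LatticeQCDFlow.Scaling.LocalDet

variable {L N : ℕ} {G : Type*} [Group G] (ρ : G →* Matrix (Fin N) (Fin N) ℂ)

/-! ### §1 The Wilson–Dirac entry as a sum of single-link terms -/
/-- Forward hopping term of the Wilson–Dirac entry `(p, q)` in direction `μ`, as a function of the
link variable `g = U(p.1, μ)`: `𝟙[q = p + μ̂]·(r - γ_μ)_{αβ}·ρ(g)_{ab}`. [folklore] -/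
def hopF (p q : TorusSite 4 L × Fin N × Fin 4) (μ : Fin 4) (r : ℝ) (g : G) : ℂ :=
  if q.1 = Site.shift p.1 μ then
    ((r : ℂ) • (1 : Matrix (Fin 4) (Fin 4) ℂ) - euclideanGamma μ) p.2.2 q.2.2 * ρ g p.2.1 q.2.1
  else 0

/-- Backward hopping term of the Wilson–Dirac entry `(p, q)` in direction `μ`, as a function of the
link variable `g = U(q.1, μ)`: `𝟙[p = q + μ̂]·(r + γ_μ)_{αβ}·ρ(g⁻¹)_{ab}`. [folklore] -/
def hopB (p q : TorusSite 4 L × Fin N × Fin 4) (μ : Fin 4) (r : ℝ) (g : G) : ℂ :=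
  if p.1 = Site.shift q.1 μ then
    ((r : ℂ) • (1 : Matrix (Fin 4) (Fin 4) ℂ) + euclideanGamma μ) p.2.2 q.2.2 * ρ g⁻¹ p.2.1 q.2.1
  else 0

/-- The tree's `wilsonDirac` entry, read as mass term minus half the sum over directions of the
forward term in the link `U(p.1, μ)` and the backward term in the link `U(q.1, μ)`. [folklore] -/
theorem wilsonDirac_apply_eq (U : GaugeConfig 4 L G) (m r : ℝ) (p q : TorusSite 4 L × Fin N × Fin 4) :
    wilsonDirac ρ U m r p q =
      (if p = q then ((m + 4 * r : ℝ) : ℂ) else 0) -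
        (1 / 2 : ℂ) * ∑ μ : Fin 4, (hopF ρ p q μ r (U (p.1, μ)) + hopB ρ p q μ r (U (q.1, μ))) := by
  simp only [wilsonDirac, Matrix.of_apply, hopF, hopB]

/-- At `r = 1` the forward hopping term has modulus `≤ 2` (`|(1 - γ_μ)_{αβ}| ≤ 2`, unitary `ρ`). [folklore] -/
theorem norm_hopF_le (hρ : ∀ g, ρ g ∈ Matrix.unitaryGroup (Fin N) ℂ)
    (p q : TorusSite 4 L × Fin N × Fin 4) (μ : Fin 4) (g : G) : ‖hopF ρ p q μ 1 g‖ ≤ 2 := by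
  unfold hopF
  split_ifs
  · rw [norm_mul]
    calc _ ≤ 2 * 1 := mul_le_mul (norm_one_sub_add_euclideanGamma_apply_le μ _ _).1
          (entry_norm_bound_of_unitary (hρ _) _ _) (norm_nonneg _) zero_le_two
      _ = 2 := by norm_num
  · simp

/-- At `r = 1` the backward hopping term has modulus `≤ 2`. [folklore] -/
theorem norm_hopB_le (hρ : ∀ g, ρ g ∈ Matrix.unitaryGroup (Fin N) ℂ)
    (p q : TorusSite 4 L × Fin N × Fin 4) (μ : Fin 4) (g : G) : ‖hopB ρ p q μ 1 g‖ ≤ 2 := by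
  unfold hopB
  split_ifs
  · rw [norm_mul]
    calc _ ≤ 2 * 1 := mul_le_mul (norm_one_sub_add_euclideanGamma_apply_le μ _ _).2
          (entry_norm_bound_of_unitary (hρ _) _ _) (norm_nonneg _) zero_le_two
      _ = 2 := by norm_num
  · simp

/-- **Entries of a difference of two Wilson–Dirac operators are bounded by `16`** (same mass,
`r = 1`, any two gauge fields): the mass term cancels and each of the `4 + 4` hopping terms moves by
at most `2 + 2`. [folklore] -/
theorem norm_wilsonDirac_sub_apply_le (hρ : ∀ g, ρ g ∈ Matrix.unitaryGroup (Fin N) ℂ)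
    (U V : GaugeConfig 4 L G) (m : ℝ) (p q : TorusSite 4 L × Fin N × Fin 4) :
    ‖(wilsonDirac ρ V m 1 - wilsonDirac ρ U m 1) p q‖ ≤ 16 := by
  rw [Matrix.sub_apply, wilsonDirac_apply_eq, wilsonDirac_apply_eq, sub_sub_sub_cancel_left,
    ← mul_sub, ← Finset.sum_sub_distrib, norm_mul]
  have hs : ‖∑ μ : Fin 4, (hopF ρ p q μ 1 (U (p.1, μ)) + hopB ρ p q μ 1 (U (q.1, μ)) -
      (hopF ρ p q μ 1 (V (p.1, μ)) + hopB ρ p q μ 1 (V (q.1, μ))))‖ ≤ 32 := by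
    refine (norm_sum_le _ _).trans ?_
    calc _ ≤ ∑ _μ : Fin 4, (8 : ℝ) := Finset.sum_le_sum fun μ _ => by
            refine (norm_sub_le _ _).trans ?_
            have := norm_hopF_le ρ hρ p q μ (U (p.1, μ))
            have := norm_hopB_le ρ hρ p q μ (U (q.1, μ))
            have := norm_hopF_le ρ hρ p q μ (V (p.1, μ))
            have := norm_hopB_le ρ hρ p q μ (V (q.1, μ))
            have := norm_add_le (hopF ρ p q μ 1 (U (p.1, μ))) (hopB ρ p q μ 1 (U (q.1, μ)))
            have := norm_add_le (hopF ρ p q μ 1 (V (p.1, μ))) (hopB ρ p q μ 1 (V (q.1, μ)))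
            linarith
      _ = 32 := by norm_num
  calc ‖(1 / 2 : ℂ)‖ * _ ≤ (1 / 2) * 32 := by
        refine mul_le_mul (by simp) hs (norm_nonneg _) (by norm_num)
    _ = 16 := by norm_num

/-! ### §2 Single-link changes: support and background independence -/
/-- The fermion indices touched by the link `ℓ = (x, μ)`: colour–spin indices at the two sites
`x` and `x + μ̂`. [folklore] -/
def linkSupport (ℓ : Edge 4 L) : Finset (TorusSite 4 L × Fin N × Fin 4) :=
  ({ℓ.1, Site.shift ℓ.1 ℓ.2} : Finset (TorusSite 4 L)) ×ˢ Finset.univ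

/-- Membership in `linkSupport ℓ` is a condition on the site component only. [folklore] -/
theorem mem_linkSupport {ℓ : Edge 4 L} {p : TorusSite 4 L × Fin N × Fin 4} :
    p ∈ (linkSupport ℓ : Finset (TorusSite 4 L × Fin N × Fin 4)) ↔
      p.1 = ℓ.1 ∨ p.1 = Site.shift ℓ.1 ℓ.2 := by
  simp [linkSupport, Finset.mem_product]

/-- `#linkSupport ℓ ≤ 8N` (two sites, `N` colours, four spins). [folklore] -/
theorem card_linkSupport_le (ℓ : Edge 4 L) :
    (linkSupport ℓ : Finset (TorusSite 4 L × Fin N × Fin 4)).card ≤ 8 * N := by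
  rw [linkSupport, Finset.card_product, Finset.card_univ, Fintype.card_prod, Fintype.card_fin,
    Fintype.card_fin]
  have h := Finset.card_insert_le ℓ.1 ({Site.shift ℓ.1 ℓ.2} : Finset (TorusSite 4 L))
  rw [Finset.card_singleton] at h
  calc _ ≤ 2 * (N * 4) := Nat.mul_le_mul_right _ h
    _ = 8 * N := by ring

/-- **Background independence**: the change of `D_W` under `U ↦ update U ℓ g` is the same for any
two fields that agree AT `ℓ` (the entry is a sum of single-link terms). [folklore] -/
theorem wilsonDirac_update_sub_apply_eq_of_agree (V W : GaugeConfig 4 L G) (ℓ : Edge 4 L) (g : G)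
    (hVW : V ℓ = W ℓ) (m r : ℝ) (p q : TorusSite 4 L × Fin N × Fin 4) :
    (wilsonDirac ρ (update V ℓ g) m r - wilsonDirac ρ V m r) p q =
      (wilsonDirac ρ (update W ℓ g) m r - wilsonDirac ρ W m r) p q := by
  have key : ∀ (k : Edge 4 L) (φ : G → ℂ),
      φ (update V ℓ g k) - φ (V k) = φ (update W ℓ g k) - φ (W k) := by
    intro k φ
    by_cases hk : k = ℓ
    · subst hk; rw [update_self, update_self, hVW]
    · rw [update_of_ne hk, update_of_ne hk, sub_self, sub_self]
  rw [Matrix.sub_apply, Matrix.sub_apply, wilsonDirac_apply_eq, wilsonDirac_apply_eq,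
    wilsonDirac_apply_eq, wilsonDirac_apply_eq, sub_sub_sub_cancel_left, sub_sub_sub_cancel_left,
    ← mul_sub, ← mul_sub, ← Finset.sum_sub_distrib, ← Finset.sum_sub_distrib]
  congr 1
  refine Finset.sum_congr rfl fun μ _ => ?_
  have h1 := key (p.1, μ) (hopF ρ p q μ r)
  have h2 := key (q.1, μ) (hopB ρ p q μ r)
  linear_combination -(h1 + h2)

/-- **Support of a single-link change**: entries of `D_W(update U ℓ g) - D_W(U)` vanish outside
`linkSupport ℓ × linkSupport ℓ`. [folklore] -/
theorem wilsonDirac_update_sub_support (U : GaugeConfig 4 L G) (ℓ : Edge 4 L) (g : G) (m r : ℝ)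
    (p q : TorusSite 4 L × Fin N × Fin 4)
    (h : (wilsonDirac ρ (update U ℓ g) m r - wilsonDirac ρ U m r) p q ≠ 0) :
    p ∈ (linkSupport ℓ : Finset (TorusSite 4 L × Fin N × Fin 4)) ∧
      q ∈ (linkSupport ℓ : Finset (TorusSite 4 L × Fin N × Fin 4)) := by
  rw [mem_linkSupport, mem_linkSupport]
  by_contra hc
  apply h
  rw [Matrix.sub_apply, wilsonDirac_apply_eq, wilsonDirac_apply_eq, sub_sub_sub_cancel_left,
    ← mul_sub, ← Finset.sum_sub_distrib]
  refine mul_eq_zero_of_right _ (Finset.sum_eq_zero fun μ _ => ?_)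
  obtain ⟨x, ν⟩ := ℓ
  have hF : hopF ρ p q μ r (update U (x, ν) g (p.1, μ)) = hopF ρ p q μ r (U (p.1, μ)) := by
    by_cases hk : (p.1, μ) = (x, ν)
    · obtain ⟨hx, hμ⟩ := Prod.mk.inj hk
      subst hx hμ
      unfold hopF
      split_ifs with hq
      · exact absurd ⟨Or.inl rfl, Or.inr hq⟩ hc
      · rfl
    · rw [update_of_ne hk]
  have hB : hopB ρ p q μ r (update U (x, ν) g (q.1, μ)) = hopB ρ p q μ r (U (q.1, μ)) := by
    by_cases hk : (q.1, μ) = (x, ν)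
    · obtain ⟨hx, hμ⟩ := Prod.mk.inj hk
      subst hx hμ
      unfold hopB
      split_ifs with hp
      · exact absurd ⟨Or.inr hp, Or.inl rfl⟩ hc
      · rfl
    · rw [update_of_ne hk]
  rw [hF, hB, sub_self]

/-- **Additivity for two distinct links**: `D_W(U₁₂) = D_W(U) + E₁ + E₂` with `E_i = D_W(U_i) - D_W(U)`,
`U_i = update U ℓ_i g_i`, `U₁₂ = update U₁ ℓ₂ g₂`. [folklore] -/
theorem wilsonDirac_update_update (U : GaugeConfig 4 L G) {ℓ₁ ℓ₂ : Edge 4 L} (hℓ : ℓ₁ ≠ ℓ₂)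
    (g₁ g₂ : G) (m r : ℝ) :
    wilsonDirac ρ (update (update U ℓ₁ g₁) ℓ₂ g₂) m r =
      wilsonDirac ρ U m r + (wilsonDirac ρ (update U ℓ₁ g₁) m r - wilsonDirac ρ U m r) +
        (wilsonDirac ρ (update U ℓ₂ g₂) m r - wilsonDirac ρ U m r) := by
  ext p q
  have h := wilsonDirac_update_sub_apply_eq_of_agree ρ (update U ℓ₁ g₁) U ℓ₂ g₂
    (update_of_ne hℓ.symm g₁ U) m r p q
  simp only [Matrix.sub_apply, Matrix.add_apply] at h ⊢
  linear_combination h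

/-! ### §3 Heavy-mass inputs from the tree -/
section Heavy

variable [NeZero L]

/-- For `m > 0` every entry of the propagator is `≤ m⁻¹ (4/(m+4))^{d_i(p,q)}` for each coordinate
`i` (the tree's `norm_inv_wilsonDirac_apply_le` with its prefactor in closed form).
[cite: MontvayMunster1994, §5.1.3] -/
theorem norm_inv_wilsonDirac_apply_le_decay (hρ : ∀ g, ρ g ∈ Matrix.unitaryGroup (Fin N) ℂ)
    (U : GaugeConfig 4 L G) {m : ℝ} (hm : 0 < m) (p q : TorusSite 4 L × Fin N × Fin 4) (i : Fin 4) :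
    ‖(wilsonDirac ρ U m 1)⁻¹ p q‖ ≤ m⁻¹ * (4 / (m + 4)) ^ (p.1 i - q.1 i).valMinAbs.natAbs := by
  have h := (norm_inv_wilsonDirac_apply_le ρ hρ U hm p q i).2
  rwa [heavy_prefactor_eq hm] at h

/-- For `m > 0` every entry of the propagator is `≤ m⁻¹`. [cite: MontvayMunster1994, §5.1.3] -/
theorem norm_inv_wilsonDirac_apply_le_inv_mass (hρ : ∀ g, ρ g ∈ Matrix.unitaryGroup (Fin N) ℂ)
    (U : GaugeConfig 4 L G) {m : ℝ} (hm : 0 < m) (p q : TorusSite 4 L × Fin N × Fin 4) :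
    ‖(wilsonDirac ρ U m 1)⁻¹ p q‖ ≤ m⁻¹ := by
  refine (norm_inv_wilsonDirac_apply_le_decay ρ hρ U hm p q 0).trans ?_
  refine mul_le_of_le_one_right (by positivity) (pow_le_one₀ (by positivity) ?_)
  rw [div_le_one (by linarith)]
  linarith

/-! ### §4 The quark effective action and the single-link Lipschitz law -/
/-- The one-flavour quark effective action `S_q(U) = -log det D_W(U, m)` (`r = 1`); for `m > 0` the
determinant is a positive real, so `‖det‖` is the determinant itself
(`norm_fermionDet_wilsonDirac_eq_re`). [folklore] -/
def quarkEffAction (U : GaugeConfig 4 L G) (m : ℝ) : ℝ :=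
  -Real.log ‖fermionDet (wilsonDirac ρ U m 1)‖

/-- `exp (-S_q(U)) = det D_W(U) = ‖det D_W(U)‖` for `m > 0`. [folklore] -/
theorem exp_neg_quarkEffAction (hρ : ∀ g, ρ g ∈ Matrix.unitaryGroup (Fin N) ℂ)
    (U : GaugeConfig 4 L G) {m : ℝ} (hm : 0 < m) :
    Real.exp (-quarkEffAction ρ U m) = ‖fermionDet (wilsonDirac ρ U m 1)‖ := by
  rw [quarkEffAction, neg_neg, Real.exp_log]
  exact norm_pos_iff.2 (isUnit_det_wilsonDirac ρ hρ U hm).ne_zero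

/-- **SINGLE-LINK LIPSCHITZ LAW (heavy quarks).**  For `m > 0`, every torus `(ℤ/L)⁴`, every gauge
field `U`, every link `ℓ` and every new value `g` of that link:
`|S_q(update U ℓ g) - S_q(U)| ≤ log ((8N)!·(1 + 8N·16/m)^{8N})` — a constant depending on the number
of colours and the bare mass only, NOT on the volume. [folklore] -/
theorem abs_quarkEffAction_update_sub_le (hρ : ∀ g, ρ g ∈ Matrix.unitaryGroup (Fin N) ℂ)
    (U : GaugeConfig 4 L G) (ℓ : Edge 4 L) (g : G) {m : ℝ} (hm : 0 < m) :
    |quarkEffAction ρ (update U ℓ g) m - quarkEffAction ρ U m| ≤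
      Real.log ((8 * N).factorial * (1 + (8 * N : ℕ) * (m⁻¹ * 16)) ^ (8 * N)) := by
  set D := wilsonDirac ρ U m 1 with hD
  set D' := wilsonDirac ρ (update U ℓ g) m 1 with hD'
  set s : Finset (TorusSite 4 L × Fin N × Fin 4) := linkSupport ℓ with hs
  have hDE : D + (D' - D) = D' := by abel
  have hunit : IsUnit D.det := isUnit_det_wilsonDirac ρ hρ U hm
  have hunit' : IsUnit (D + (D' - D)).det := by
    rw [hDE]; exact isUnit_det_wilsonDirac ρ hρ _ hm
  have hE : ∀ i j, (D' - D) i j ≠ 0 → i ∈ s ∧ j ∈ s := fun i j h =>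
    wilsonDirac_update_sub_support ρ U ℓ g m 1 i j h
  have ha : ∀ i j, ‖D⁻¹ i j‖ ≤ m⁻¹ := fun i j => norm_inv_wilsonDirac_apply_le_inv_mass ρ hρ U hm i j
  have ha' : ∀ i j, ‖(D + (D' - D))⁻¹ i j‖ ≤ m⁻¹ := fun i j => by
    rw [hDE]; exact norm_inv_wilsonDirac_apply_le_inv_mass ρ hρ _ hm i j
  have he : ∀ i j, ‖(D' - D) i j‖ ≤ 16 := fun i j =>
    norm_wilsonDirac_sub_apply_le ρ hρ U (update U ℓ g) m i j
  have hmain := abs_log_norm_det_add_sub_le D (D' - D) s (inv_nonneg.2 hm.le) (by norm_num)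
    hunit hunit' hE ha ha' he
  rw [hDE] at hmain
  have hcard : s.card ≤ 8 * N := card_linkSupport_le ℓ
  have hmono := factorial_mul_pow_mono hcard (c := m⁻¹ * 16) (by positivity)
  have hC1 := one_le_factorial_mul_pow s.card (c := m⁻¹ * 16) (by positivity)
  rw [quarkEffAction, quarkEffAction, show ∀ a b : ℝ, -a - -b = -(a - b) from fun a b => by ring,
    abs_neg]
  exact hmain.trans (Real.log_le_log (by linarith) hmono)

/-! ### §5 The two-link decoupling law -/
/-- **TWO-LINK DECOUPLING LAW (heavy quarks), determinant form.**  Let `m > 0`, `ℓ₁ ≠ ℓ₂` two links,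
`U₁ = update U ℓ₁ g₁`, `U₂ = update U ℓ₂ g₂`, `U₁₂ = update U₁ ℓ₂ g₂`, and suppose the endpoint sets
`{x₁, x₁ + μ̂₁}`, `{x₂, x₂ + μ̂₂}` are at cyclic distance `≥ R` in the coordinate direction `i`.  Then
for every `δ ≥ (8N)·(8N)²·16²·m⁻¹·(m⁻¹ (4/(m+4))^R)`:
`‖det D(U₁₂)·det D(U) / (det D(U₁)·det D(U₂)) - 1‖ ≤ ((8N)! + 8N)·δ·(1 + δ)^{8N - 1}` — exponential
decoupling at rate `log ((m+4)/4) = log (1/(8κ))` per lattice step, uniformly in `L` and `U`. [folklore] -/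
theorem norm_fermionDet_crossRatio_sub_one_le (hρ : ∀ g, ρ g ∈ Matrix.unitaryGroup (Fin N) ℂ)
    (U : GaugeConfig 4 L G) {ℓ₁ ℓ₂ : Edge 4 L} (hℓ : ℓ₁ ≠ ℓ₂) (g₁ g₂ : G) {m : ℝ} (hm : 0 < m)
    (i : Fin 4) (R : ℕ)
    (hR : ∀ x ∈ ({ℓ₁.1, Site.shift ℓ₁.1 ℓ₁.2} : Finset (TorusSite 4 L)),
      ∀ y ∈ ({ℓ₂.1, Site.shift ℓ₂.1 ℓ₂.2} : Finset (TorusSite 4 L)), R ≤ (x i - y i).valMinAbs.natAbs)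
    {δ : ℝ} (hδ : (8 * N : ℝ) * (8 * N) ^ 2 * 16 ^ 2 * m⁻¹ * (m⁻¹ * (4 / (m + 4)) ^ R) ≤ δ) :
    ‖fermionDet (wilsonDirac ρ (update (update U ℓ₁ g₁) ℓ₂ g₂) m 1) *
          fermionDet (wilsonDirac ρ U m 1) /
        (fermionDet (wilsonDirac ρ (update U ℓ₁ g₁) m 1) *
          fermionDet (wilsonDirac ρ (update U ℓ₂ g₂) m 1)) - 1‖ ≤
      (((8 * N).factorial : ℝ) + (8 * N : ℕ)) * δ * (1 + δ) ^ (8 * N - 1) := by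
  set D := wilsonDirac ρ U m 1 with hD
  set E₁ := wilsonDirac ρ (update U ℓ₁ g₁) m 1 - D with hE₁
  set E₂ := wilsonDirac ρ (update U ℓ₂ g₂) m 1 - D with hE₂
  set s₁ : Finset (TorusSite 4 L × Fin N × Fin 4) := linkSupport ℓ₁ with hs₁
  set s₂ : Finset (TorusSite 4 L × Fin N × Fin 4) := linkSupport ℓ₂ with hs₂
  have hθ0 : (0 : ℝ) ≤ 4 / (m + 4) := by positivity
  have hθ1 : 4 / (m + 4) ≤ (1 : ℝ) := by rw [div_le_one (by linarith)]; linarith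
  have h1 : D + E₁ = wilsonDirac ρ (update U ℓ₁ g₁) m 1 := by rw [hE₁]; abel
  have h2 : D + E₂ = wilsonDirac ρ (update U ℓ₂ g₂) m 1 := by rw [hE₂]; abel
  have h12 : D + E₁ + E₂ = wilsonDirac ρ (update (update U ℓ₁ g₁) ℓ₂ g₂) m 1 := by
    rw [wilsonDirac_update_update ρ U hℓ g₁ g₂ m 1]
  have hu₁ : IsUnit (D + E₁).det := by rw [h1]; exact isUnit_det_wilsonDirac ρ hρ _ hm
  have hu₂ : IsUnit (D + E₂).det := by rw [h2]; exact isUnit_det_wilsonDirac ρ hρ _ hm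
  have hS₁ : ∀ i j, E₁ i j ≠ 0 → i ∈ s₁ ∧ j ∈ s₁ := fun i j h =>
    wilsonDirac_update_sub_support ρ U ℓ₁ g₁ m 1 i j h
  have hS₂ : ∀ i j, E₂ i j ≠ 0 → i ∈ s₂ ∧ j ∈ s₂ := fun i j h =>
    wilsonDirac_update_sub_support ρ U ℓ₂ g₂ m 1 i j h
  have he₁ : ∀ i j, ‖E₁ i j‖ ≤ 16 := fun i j => norm_wilsonDirac_sub_apply_le ρ hρ U _ m i j
  have he₂ : ∀ i j, ‖E₂ i j‖ ≤ 16 := fun i j => norm_wilsonDirac_sub_apply_le ρ hρ U _ m i j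
  have ha : ∀ i j, ‖(D + E₂)⁻¹ i j‖ ≤ m⁻¹ := fun i j => by
    rw [h2]; exact norm_inv_wilsonDirac_apply_le_inv_mass ρ hρ _ hm i j
  have hb : ∀ k ∈ s₁, ∀ l ∈ s₂, ‖(D + E₁)⁻¹ k l‖ ≤ m⁻¹ * (4 / (m + 4)) ^ R := by
    intro k hk l hl
    rw [h1]
    refine (norm_inv_wilsonDirac_apply_le_decay ρ hρ _ hm k l i).trans ?_
    refine mul_le_mul_of_nonneg_left (pow_le_pow_of_le_one hθ0 hθ1 ?_) (by positivity)
    rw [hs₁, mem_linkSupport] at hk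
    rw [hs₂, mem_linkSupport] at hl
    refine hR (k.1) ?_ (l.1) ?_
    · rcases hk with h | h <;> simp [h]
    · rcases hl with h | h <;> simp [h]
  have hc₁ : (s₁.card : ℝ) ≤ 8 * N := by exact_mod_cast card_linkSupport_le ℓ₁
  have hc₂ : (s₂.card : ℝ) ≤ 8 * N := by exact_mod_cast card_linkSupport_le ℓ₂
  have hδ' : (s₁.card : ℝ) * s₂.card ^ 2 * 16 ^ 2 * m⁻¹ * (m⁻¹ * (4 / (m + 4)) ^ R) ≤ δ := by
    refine le_trans ?_ hδ
    have : (0 : ℝ) ≤ m⁻¹ * (4 / (m + 4)) ^ R := by positivity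
    have : (0 : ℝ) ≤ m⁻¹ := by positivity
    gcongr
  have hmain := norm_det_ratio_sub_one_le D E₁ E₂ s₁ s₂ (a := m⁻¹) (b := m⁻¹ * (4 / (m + 4)) ^ R)
    (e := 16) (by positivity) (by positivity) (by norm_num) hu₁ hu₂ hS₁ hS₂ he₁ he₂ ha hb hδ'
  rw [h12, h1, h2] at hmain
  have hδ0 : 0 ≤ δ := le_trans (by positivity) hδ
  exact hmain.trans (factorial_add_mul_mono (card_linkSupport_le ℓ₁) hδ0)

/-- **TWO-LINK DECOUPLING LAW, effective-action form**: with `Δ₁Δ₂S_q := S_q(U₁₂) - S_q(U₁) -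
S_q(U₂) + S_q(U)` the connected two-link coupling of the quark effective action,
`|exp (-Δ₁Δ₂S_q) - 1| ≤ ((8N)! + 8N)·δ·(1 + δ)^{8N-1}` for every `δ ≥ 2¹⁷N³ m⁻² (4/(m+4))^R` — the
heavy-quark case of conjecture C5 with localisation length `1/log ((m+4)/4)`. [folklore] -/
theorem abs_exp_neg_secondDiff_quarkEffAction_sub_one_le
    (hρ : ∀ g, ρ g ∈ Matrix.unitaryGroup (Fin N) ℂ)
    (U : GaugeConfig 4 L G) {ℓ₁ ℓ₂ : Edge 4 L} (hℓ : ℓ₁ ≠ ℓ₂) (g₁ g₂ : G) {m : ℝ} (hm : 0 < m)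
    (i : Fin 4) (R : ℕ)
    (hR : ∀ x ∈ ({ℓ₁.1, Site.shift ℓ₁.1 ℓ₁.2} : Finset (TorusSite 4 L)),
      ∀ y ∈ ({ℓ₂.1, Site.shift ℓ₂.1 ℓ₂.2} : Finset (TorusSite 4 L)), R ≤ (x i - y i).valMinAbs.natAbs)
    {δ : ℝ} (hδ : (8 * N : ℝ) * (8 * N) ^ 2 * 16 ^ 2 * m⁻¹ * (m⁻¹ * (4 / (m + 4)) ^ R) ≤ δ) :
    |Real.exp (-(quarkEffAction ρ (update (update U ℓ₁ g₁) ℓ₂ g₂) m -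
          quarkEffAction ρ (update U ℓ₁ g₁) m - quarkEffAction ρ (update U ℓ₂ g₂) m +
          quarkEffAction ρ U m)) - 1| ≤
      (((8 * N).factorial : ℝ) + (8 * N : ℕ)) * δ * (1 + δ) ^ (8 * N - 1) := by
  have h := norm_fermionDet_crossRatio_sub_one_le ρ hρ U hℓ g₁ g₂ hm i R hR hδ
  have hexp : Real.exp (-(quarkEffAction ρ (update (update U ℓ₁ g₁) ℓ₂ g₂) m -
      quarkEffAction ρ (update U ℓ₁ g₁) m - quarkEffAction ρ (update U ℓ₂ g₂) m +
      quarkEffAction ρ U m)) =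
      ‖fermionDet (wilsonDirac ρ (update (update U ℓ₁ g₁) ℓ₂ g₂) m 1) *
          fermionDet (wilsonDirac ρ U m 1) /
        (fermionDet (wilsonDirac ρ (update U ℓ₁ g₁) m 1) *
          fermionDet (wilsonDirac ρ (update U ℓ₂ g₂) m 1))‖ := by
    rw [norm_div, norm_mul, norm_mul, ← exp_neg_quarkEffAction ρ hρ _ hm,
      ← exp_neg_quarkEffAction ρ hρ U hm, ← exp_neg_quarkEffAction ρ hρ (update U ℓ₁ g₁) hm,
      ← exp_neg_quarkEffAction ρ hρ (update U ℓ₂ g₂) hm, ← Real.exp_add, ← Real.exp_add,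
      ← Real.exp_sub]
    congr 1
    ring
  set z : ℂ := fermionDet (wilsonDirac ρ (update (update U ℓ₁ g₁) ℓ₂ g₂) m 1) *
      fermionDet (wilsonDirac ρ U m 1) /
    (fermionDet (wilsonDirac ρ (update U ℓ₁ g₁) m 1) *
      fermionDet (wilsonDirac ρ (update U ℓ₂ g₂) m 1)) with hz
  rw [hexp]
  calc |‖z‖ - 1| = |‖z‖ - ‖(1 : ℂ)‖| := by rw [norm_one]
    _ ≤ ‖z - 1‖ := abs_norm_sub_norm_le _ _
    _ ≤ _ := h

end Heavy

end Summit.Ventures.LatticeQCDFlow.Scaling.HeavyQuark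

end
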